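import Mathlib
import HarnessLib
import HarnessLib.Audit
import Summits.CriticalPhenomena.Statement
import Literature.Probability.RandomPlanarGeometry.ConformalWelding
import Summits.CriticalPhenomena.SAWScalingLimit.Theorems.SAWRenewalTightnessEventualTightOfBoundedVirginArc
import Summits.CriticalPhenomena.SAWScalingLimit.Theorems.SAWCircleScreeningChordalSLE83Exists
import Literature.Probability.Process.KolmogorovExtensionProofs
import Literature.Probability.RandomPlanarGeometry.SLEUniquenessInLaw
import HarnessLib.Audit.Status.Attr

/-!
Route: SAWWeldingIdentification

# Route SAWWeldingIdentification — identify the Z2 SAW limit by the law of its two-sided conformal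
welding plus removability (SLE(8/3) zipper)

It suffices to show X = (W) ∧ (R) ∧ (T) [card welding-zipper-identification: "read the stitching,
know the curve"]. Fix a Dobrushin
domain D = (Ω; a, b), completed to a conformal rectangle Q = (Ω; a, c_L, b, c_R) (one auxiliary
marked point on each boundary arc, so
that the two banks L, R of a simple chord γ from a to b have CANONICAL uniformisers φ : ℍ → L (0 ↦
a, ∞ ↦ b, s ↦ c_L) and
ψ : ℍ → R (0 ↦ a, ∞ ↦ b, −s ↦ c_R), s = ±1 the orientation of ∂Ω); the conformal welding of γ is the
increasing homeomorphism h of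
(0, ∞) with ψ(s·x) = φ(−s·h(x)). (W) WeldingLawOfLimit: every subsequential weak limit P of the
critical δℤ² SAW laws in (Ω; a_δ, b_δ)
has the same welding law (all finite-dimensional marginals of h) as chordal SLE_{8/3} in (Ω; a, b).
(R) RemovableLimit: P-a.s. the limit
curve is a simple chord meeting ∂Ω only at a, b and conformally removable inside Ω. (T)
EventualTight: the SAW laws are tight for δ ≤ δ₀.
Then welding rigidity (a removable chord is determined by its welding, JonesSmirnov2000 /
Sheffield2016) and the a.s. removability of
SLE_{8/3} (RohdeSchramm2005 Hölder banks) identify every subsequential limit with the SLE_{8/3} law,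
and tightness upgrades this to
SAWScalingLimit. No conformal covariance, restriction property or discrete observable is ever
asserted of the SAW.
Lean: `WeldingLawOfLimit ∧ RemovableLimit ∧ EventualTight`

## Assembly
Standard reductions, no new mathematics — realised as the PROVED deciding theorem `closes` of the
route file (rev 5, standard
axioms, no Literature fact, no import beyond the base except the proved theorem files
SLEUniquenessInLaw and
KolmogorovExtensionProofs): fix D, a, b with IsEndpointApprox; complete D to a conformal rectangle Q
with Q.chord 0 2 = D (one mark
inserted in each open boundary arc, proved inline); let Γ be a chordal SLE_{8/3} random curve in D
given by the support item
ChordalSLE83Exists (shared with route SAWCircleScreening; provable now — it is the in-tree theorem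
exists_isSLECurve_eightThirds,
Rohde–Schramm Thm 5.1 + Thm 7.1 at κ = 8/3 ≠ 8; filed as an item rather than imported so that the
theses file does not import the
206-module RS05 proof tower with its unproved co-resident SLE₈/percolation/Itô facts) and μ =
preWienerMeasure.map Γ its law (a
probability measure: the Wiener measure is one by the proved Kolmogorov extension theorem,
exists_isProjectiveLimit_holds →
isProjectiveLimit_preWienerMeasure_of → isProbabilityMeasure_preWienerMeasure).
For any subsequential weak limit P: RemovableLimit gives P-a.s. removable simple chords,
SLERemovableChord gives the same for Γ ω a.s.,
WeldingSetup gives the sign s of Q, the bank configurations and a measurable welding functional W,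
WeldingRigidity (with h q := W Q γ q)
makes W injective on removable chords through its positive-rational values, WeldingLawOfLimit (its
antecedent IsSLECurve.map_eq is the
theorem IsSLECurve.map_eq_holds) gives equality of the finite-dimensional W-marginals of P and μ at
rational points, so the one-sided
Lusin–Souslin item IdentifyFromWelding yields P = μ; LimitUpgrade with EventualTight turns "every
subsequential limit is μ" into
TendstoLaw … id μ, and integral_map (Γ a.e.-measurable, SAW.aemeasurable_curve) rewrites it as
TendstoLaw … Γ preWienerMeasure, i.e.
ConvergesInLawToSLE (8/3) D, i.e. SAWScalingLimit. Hypotheses of `closes` = WeldingLawOfLimit,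
RemovableLimit, EventualTight,
WeldingSetup, WeldingRigidity, SLERemovableChord, IdentifyFromWelding, LimitUpgrade,
ChordalSLE83Exists (WeldingContinuity serves
WeldingSetup's measurability clause; IdentifyFromWeldingAE is the Ω' = Wiener-space special case of
IdentifyFromWelding). ASSEMBLY ITEM (route-repair g9,
2026-08-15): the route has ONE assembly statement — the type of `closes` itself, `WeldingLawOfLimit
→ RemovableLimit → EventualTight →
WeldingSetup → WeldingRigidity → SLERemovableChord → IdentifyFromWelding → LimitUpgrade →
ChordalSLE83Exists → SAWScalingLimit` — which a
gate artefact records under THREE assembly-kind decls (`Assembly` = stmt-11048, `Assembly2` =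
stmt-4510 the genuine rank-1 item, `Assembly22` =
stmt-6920; decl names are assigned by item-id order). All three bodies were set to this one
statement by `workitem set-signature` (planner --drop /
--retriage of assembly-kind items is refused by the gate, re-verified by seats g4–g9), so each
record is proved by the term `closes` (checked:
`theorem assemblyT_holds : <that statement> := closes`, lean rc 0, axioms propext / Classical.choice
/ Quot.sound). Provers: land
`theorem assembly_holds : Assembly := closes`, `theorem assembly2_holds : Assembly2 := closes`,
`theorem assembly22_holds : Assembly22 := closes` in
Summits/CriticalPhenomena/SAWScalingLimit/Theorems/SAWWeldingAssembly.lean (import the Theses file)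
and close the three records; operator: drop the
wants of stmt-11048 and stmt-6920 (bookkeeping only — nothing in `closes` refers to any Assembly
decl).

Rationale: WHY THIS LINE. Sheffield's quantum zipper (Sheffield2016, arXiv:1012.4797 Thm 1.3–1.4;
DuplantierMillerSheffield2021 Thm 1.2 with wedge weights
w₁ = w₂ = 2) says that chordal SLE_κ, κ = γ² < 4, is the seam obtained by conformally welding two
INDEPENDENT γ-quantum wedges along
boundary quantum length, and that the seam is a measurable function of the welding because SLE_κ (κ
< 4) bounds Hölder domains
(RohdeSchramm2005 Thm 5.2) whose boundaries are conformally removable (JonesSmirnov2000); for κ =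
8/3 the welding homeomorphism is the
quotient F_R⁻¹∘F_L of two independent √(8/3)-boundary Gaussian multiplicative chaos clocks
(existence/uniqueness of such chaos weldings:
AstalaEtAl2011, KupiainenMcauleySaksman2026). The one setting where "SAW ⇒ SLE_{8/3}" is a theorem,
GwynneMiller2021SAW on random
quadrangulations, works precisely because the SAW there is the gluing seam of two independent discs;
route SAWQuantumGravity imports
that theorem through an embedding and an environment-removal crux, whereas this line transplants its
MECHANISM to ℤ²: identify the
limit by the LAW OF ITS WELDING (a one-dimensional random homeomorphism read off the two-sided
harmonic measure of the walk) plus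
removability, instead of by conformal invariance + restriction (routes SAWConfRestriction,
SAWRestrictionRigidity) or by a discrete
holomorphic observable (SAWParafermion, SAWHexUniversality). Imported areas: conformal welding /
removability (geometric function
theory), Liouville quantum gravity and multiplicative chaos (as the engine and explicit target law
for the rank-2 crux), weak
convergence on curve space. The typed layer needs no LQG object: the target welding law is that of
SLE_{8/3} itself, over the
library's ConformalEquiv / boundaryExtension / ConformalRectangle / CurveClass / SAW.law.

RANKED CRUXES. #2 WeldingLawOfLimit (crux) — (W) of the card (its W2 ∪ W1 read at the level of
limits): for every conformal rectangle Q (Dobrushin domain Q.chord 0 2 = (Ω; a, b) with auxiliary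
marks c_L = Q.pt 1, c_R = Q.pt 3), every endpoint approximation, every probability measure P that is
a weak limit of the pushed-forward critical SAW laws along some δ_n → 0⁺, every welding functional W
(pinned on chords by the canonical uniformisers, measurable) and every chordal SLE_{8/3} random
curve Γ in (Ω; a, b): all finite-dimensional laws of (W Q γ x₁, …, W Q γ x_k), x_i > 0, under P
equal those under the law of Γ. Engine: the SLE_{8/3} welding is the quotient clock of two
independent √(8/3)-LQG boundary lengths (Sheffield2016; DuplantierMillerSheffield2021 Thm 1.2), so
the lattice task is "bank independence": the two-sided harmonic-measure parametrisations of the walk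
decouple as quantum boundary lengths. [difficulty: open-problem] (why it might fail: Bank
independence on ℤ² is conjectural: two-sided harmonic measure of fractal lattice banks needs
exponential-moment multifractal control, isotropy (Beffara's modulus) must be spent inside this
crux, and the only characterisation engines are GMC shift-covariance / KMS welding uniqueness.)
[Sheffield2016, DuplantierMillerSheffield2021, KupiainenMcauleySaksman2026, AstalaEtAl2011,
GwynneMiller2021SAW, McenteggartMillerQian2019, LawlerSchrammWerner2004SAW]
#3 RemovableLimit (crux) — (R) of the card: for every conformal rectangle Q, endpoint approximation
and subsequential weak limit P of the critical SAW laws (as in WeldingLawOfLimit), P-almost every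
curve is a simple chord of (Ω; a, b) (simple, from a to b, meeting ∂Ω only at a, b) that is
conformally removable inside Ω: every continuous injective self-map of Ω onto Ω that is holomorphic
off the curve is holomorphic on Ω. Intended engine: uniform Hölder/John estimates for the two banks
of the walk (no fjords at any scale) and the Jones–Smirnov removability of Hölder-domain boundaries.
[difficulty: XL] (why it might fail: Needs no-fjord (Hölder/John bank) estimates for the x_c-SAW at
all scales under every endpoint approximation; only sub-ballisticity is in print, simplicity of
limits is itself open, and non-removable simple limits would make the welding blind (Younsi2018).)
[JonesSmirnov2000, RohdeSchramm2005, Younsi2018, DuminilCopinHammond2013, KennedyLawler2013,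
LawlerSchrammWerner2004SAW]
#4 EventualTight (crux) — (T): for every Dobrushin domain and endpoint approximation there is δ₀ > 0
such that the pushed-forward critical SAW laws with δ ∈ (0, δ₀] form a tight set of measures on
CurveClass ℂ — the ∃δ₀ repair of the refuted all-δ statement stmt-CriticalPhenomena-0772, verbatim
the shared item stmt-CriticalPhenomena-1372 of route SAWRestrictionRigidity (deduplicated). Intended
tools: Aizenman–Burchard regularity from an annulus multi-crossing bound (Kemppainen–Smirnov
Condition G2) for the critical SAW. [difficulty: open-problem] (why it might fail: Eventual
tightness of the critical SAW is open: no annulus multi-crossing bound (KS Condition G2, AB99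
hypothesis H1) is known at x_c on ℤ²; only sub-ballisticity (DCH13) and hexagonal quantitative
bounds are in print.) [KemppainenSmirnov2017, AizenmanBurchardDuke1999, DuminilCopinHammond2013,
arXiv:2310.17299]
#9 WeldingSetup (support) — the welding is well defined: (i) for every conformal rectangle Q there
is a sign s = ±1 (the orientation of the boundary loop) such that every simple chord γ of (Ω; a, b)
has banks L, R (the two components of Ω ∖ γ, Newman's cross-cut theorem, with c_L ∈ cl L, c_R ∈ cl
R) and normalised uniformisers φ : ℍ → L (0 ↦ a, ∞ ↦ b, s ↦ c_L), ψ : ℍ → R (0 ↦ a, ∞ ↦ b, −s ↦ c_R)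
(Riemann mapping + Carathéodory + three-point normalisation); (ii) there is a welding functional W :
Q ↦ γ ↦ (x ↦ h(x)), Borel in γ for each (Q, x), with h(x) > 0 and ψ(s x) = φ(−s h(x)) for every
chord, every such configuration and every x > 0 (uniqueness of normalised uniformisers makes h
configuration-independent; measurability via WeldingContinuity on the Borel set of chords).
[difficulty: L] [AhlforsCA1979, PommerenkeBBCM1992, Newman1939]
#9 WeldingRigidity (support) — a removable chord is determined by its welding: if γ, γ' are simple
chords of (Ω; a, b), γ conformally removable inside Ω, with banks and normalised uniformisers (φ,
ψ), (φ', ψ') for the same sign s, and a common welding on the positive rationals (h(q) > 0, ψ(s q) =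
φ(−s h q) and ψ'(s q) = φ'(−s h q) for all rational q > 0), then γ = γ'. Proof sketch: F := φ'∘φ⁻¹
on L, ψ'∘ψ⁻¹ on R extends across γ (the two boundary correspondences agree on the dense set ψ(sℚ₊))
to a continuous bijection Ω → Ω holomorphic off γ, hence (removability) a conformal automorphism of
Ω fixing the three boundary points a, b, c_L, hence the identity. Classical: JonesSmirnov2000 §1,
Sheffield2016 §1.4 (welding uniqueness), Carathéodory boundary correspondence. [difficulty: M]
[JonesSmirnov2000, Sheffield2016, McenteggartMillerQian2019, PommerenkeBBCM1992]
#9 SLERemovableChord (support) — Literature fact wanted: for every conformal rectangle Q and every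
chordal SLE_{8/3} random curve Γ in (Ω; a, b) = Q.chord 0 2, almost surely Γ is a simple chord of
(Ω; a, b) meeting ∂Ω only at a, b (Rohde–Schramm 2005 Thm 6.1: SLE_κ simple and off the boundary for
κ ≤ 4) which is conformally removable inside Ω (Rohde–Schramm 2005 Thm 5.2: complements of SLE_κ
hulls, κ ≠ 4, are Hölder domains; Jones–Smirnov 2000: Hölder-domain boundaries are removable for
(quasi)conformal homeomorphisms, a local, conformally invariant property — the form used by
Sheffield2016 §1.4). Expected to close by vendoring these facts; the local-vs-global removability
bookkeeping is the one point to audit. [difficulty: M] [RohdeSchramm2005, JonesSmirnov2000,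
Sheffield2016, arXiv:2211.15609]
#9 IdentifyFromWelding (support) — measure-theoretic glue (Lusin–Souslin): two probability measures
P, μ on CurveClass ℂ, each carried (a.e.) by removable simple chords of (Ω; a, b), on which a
measurable welding functional W separates points through its values at positive rationals, and whose
finite-dimensional W-marginals at positive rational points coincide, are equal. Proof: a.e. ⇒
measurable full-measure subsets of the removable chords; γ ↦ (W Q γ q)_q is a measurable injection
of their union into ℝ^ℕ (Polish), so images of Borel sets are Borel (Mathlib
MeasurableSet.image_of_measurable_injOn) and P(A) = P∘V⁻¹(V(A ∩ T)) = μ∘V⁻¹(V(A ∩ T)) = μ(A), the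
laws of V agreeing by the π-system of cylinders. [difficulty: provable-now] [Billingsley1999,
AizenmanBurchard1999]
#9 LimitUpgrade (support) — weak-convergence glue (Prokhorov): if the pushed-forward SAW laws of (D;
a_δ, b_δ) are eventually tight and every probability measure arising as their weak limit along a
sequence δ_n → 0⁺ equals μ, then they converge to μ along 𝓝[>]0 in the sense TendstoLaw (target r.v.
id). Proof: otherwise some bounded continuous f and δ_n → 0 keep |∫ f dlaw_n − ∫ f dμ| ≥ ε; eventual
tightness and Mathlib's Prokhorov theorem (isCompact_closure_of_isTightMeasureSet, Lévy–Prokhorov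
metrisability) extract a weakly convergent subsequence (laws are probability measures once a_δ, b_δ
are joined, IsEndpointApprox.reachable), whose limit must be μ — contradiction. [difficulty:
provable-now] [Billingsley1999, AizenmanBurchardDuke1999]
#9 WeldingContinuity (support) — the welding is continuous along chords: if simple chords γ_n of (Ω;
a, b) converge in CurveClass ℂ to a simple chord γ, then W Q γ_n x → W Q γ x for every x > 0 and
every welding functional W. Classical: uniform convergence to a SIMPLE chord forces the banks to
converge as Carathéodory kernels with uniformly locally connected complements (no fjords survive),
so the normalised uniformisers converge uniformly up to the boundary (Pommerenke 1992 Thm 1.8,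
§2.2–2.3, Cor. 2.4) and inverse boundary correspondences converge. This is the bridge from lattice
weldings (two-sided discrete harmonic measure of the walk, the card's h_δ) to WeldingLawOfLimit, and
it gives the measurability clause of WeldingSetup. [difficulty: L] [PommerenkeBBCM1992,
AhlforsCA1979]

TWO-LAYER PLAN. Foreseen glued splits (none filed now). WeldingLawOfLimit ⇐ LatticeWeldingTight (W1:
along the walk, log-increments of the lattice
welding h_δ of the completed chord — equivalently of the two-sided discrete harmonic measures — have
uniformly bounded small exponential
moments over dyadic scales, so lattice welding laws are tight among quasisymmetric-free
homeomorphisms) → BankIndependence (W2: every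
limit welding is the quotient clock of two independent √(8/3)-boundary-GMC measures modulo the
shared harmonic part, identified with the
SLE_{8/3} welding by Sheffield2016 Thm 1.3 + KupiainenMcauleySaksman2026 uniqueness) →
WeldingLawOfLimit, glue = WeldingContinuity +
EventualTight (alternative rank-2 child: the imaginary-geometry Gaussianity test of the card's
sister criterion). RemovableLimit ⇐
SimpleBoundaryAvoidingLimit (shared with SAWConfRestriction.SimpleOfLimit) → HölderBanks (uniform
Hölder/John estimate for SAW banks from
sub-ballisticity-type inputs) → RemovableLimit (glue: Jones–Smirnov transfer, local form).
EventualTight ⇐ an annulus multi-crossing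
bound at x_c (KS Condition G2) → Aizenman–Burchard (isTightMeasureSet_of_traversalBounds, in tree).

KILL CRITERIA. A subsequential SAW limit whose welding law provably differs from the SLE_{8/3}
welding law refutes WeldingLawOfLimit and — given
RemovableLimit and EventualTight — the conjunct itself: close `refuted:WeldingLawOfLimit` and record
the witness as negative knowledge for
every SAW route. Numerical non-decorrelation of the left/right clocks kills only the ENGINE (bank
independence), not the statement:
pivot the layer-2 plan to the Gaussianity test. ¬RemovableLimit (non-removable or non-simple limits
with positive probability) kills
this identification mechanism outright (the welding is blind on non-removable curves, Younsi2018):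
close `refuted:RemovableLimit`,
hand tightness/simplicity items to the restriction routes. ¬EventualTight refutes SAWScalingLimit as
typed (all routes). If
SAWConfRestriction / SAWRestrictionRigidity / SAWHexUniversality close the conjunct first, this
route is moot (close superseded);
conversely RemovableLimit and EventualTight are directly reusable by them.

NOT DECOMPOSED YET. The lattice welding h_δ itself (the walk from a_δ to b_δ is not a chord of Ω
when the endpoints are interior: completion to a chord,
or the two-sided discrete-harmonic-measure parametrisation, is layer-2 bookkeeping); the GFF-dressed
form (W') of bank independence and
the boundary-GMC clock (no LQG object in Literature — kept as the informal engine, definition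
requests filed low priority); the
multifractal/exponential-moment constants of W1; local-vs-global removability in SLERemovableChord;
John vs Hölder in the HölderBanks
child; measurability of the welding functional (inside WeldingSetup, via WeldingContinuity);
uniqueness of the SLE law is NOT needed
(one Γ per domain; IsSLECurve.map_eq enters only as the antecedent of WeldingLawOfLimit).

CHEAPEST FALSIFIER. The card's Monte-Carlo test, which refuters should run first: pivot-sample
x_c-SAW chords in a lattice disc (10³–10⁴ steps),
uniformise the two banks numerically (Schwarz–Christoffel / Marshall–Rohde zipper), and measure (a)
the multifractal spectrum of the
lattice welding h_δ against the KPZ prediction for the quotient of two independent √(8/3) boundary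
clocks, (b) the correlation of
left- and right-clock log-increments on disjoint dyadic intervals after removing the shared harmonic
part — a clearly non-vanishing
limit kills bank independence (the only engine for WeldingLawOfLimit). Not run in this session
(plancard mode, compute-free hub).
Lookup falsifier already done: welding uniqueness for removable curves and removability of SLE_κ, κ
< 4, ARE in print
(Sheffield2016 §1.4 via RohdeSchramm2005 Thm 5.2 + JonesSmirnov2000; McenteggartMillerQian2019), so
the continuum half of the line is
standard and the whole bet sits in WeldingLawOfLimit / RemovableLimit.

NUMBERS. κ = 8/3, γ = √κ = √(8/3) < 2 (simple phase κ < 4); zipper: chordal SLE_κ = welding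
interface of two independent weight-2 γ-wedges
(DuplantierMillerSheffield2021 Thm 1.2 with w₁ = w₂ = 2; Sheffield2016 Thm 1.3); SLE_κ hull
complements are Hölder domains for κ ≠ 4
(RohdeSchramm2005 Thm 5.2), SLE_κ simple for κ ≤ 4 (Thm 6.1); SAW: ν = 3/4 predicted, d_f(SLE_{8/3})
= 4/3, sub-ballisticity proved
(DuminilCopinHammond2013); restriction exponent 5/8 (LSW). Items at open: 10 (3 cruxes, 6 supports,
1 assembly). Cone (route-repair g8, 2026-08-15; needs-fact: none): the deciding theorem `closes`
(rev 5) rests on NO unproved Literature fact (gate decl-level check: 0 unproved among 91 project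
constants, staffable). Route imports = SLEUniquenessInLaw (IsSLECurve.map_eq_holds; its 50 modules
over the base cone carry 0 unproved named facts) +
Literature.Probability.Process.KolmogorovExtensionProofs (IsProbabilityMeasure preWienerMeasure; 1
module, 0 unproved). The import SLEExistenceNeEightHolds was DROPPED at rev 5: it was used for the
single theorem exists_isSLECurve_eightThirds but dragged in the 206-module Rohde–Schramm proof tower
whose co-resident unproved facts (ito_formula_itoProcess [mis-stated per its own docstring],
LawlerSchrammWerner2004_thm47, ae_infDist_sleTrace_eq_zero_of_eight_le,
ae_isSpaceFilling_sleTrace_of_eight_le, ae_dimH_range_sleTrace,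
eq_six_of_forall_measureReal_hitsBefore, RohdeSchramm2005_lem72, …) no item uses; SLE_{8/3}
existence is instead the support item ChordalSLE83Exists, so the tower enters only through PROOFS
(Theorems files), never through the theses. What remains in the module cone is the base import
Summits.CriticalPhenomena.Statement shared by every route of the summit (the other conjuncts,
exists_isSLECurve / hasSLETrace_eight / tendsto_norm_sleTrace_atTop, the gm_* isoradial-percolation
facts, FitznerVanDerHofstad2017_beta_eq_one; wi-15909) — none used by any item or by `closes`. Items
now (route-repair g9): 3 cruxes (4502 r2, 4503 r3, 1372 r4 — each with why-it-might-fail + sources),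
8 supports (incl. the shared ChordalSLE83Exists and the redundant IdentifyFromWeldingAE), and ONE
assembly statement = the type of `closes` (WeldingLawOfLimit → RemovableLimit → EventualTight →
WeldingSetup → WeldingRigidity → SLERemovableChord → IdentifyFromWelding → LimitUpgrade →
ChordalSLE83Exists → SAWScalingLimit), carried by 3 assembly-kind records with that identical body
(stmt-4510 genuine rank 1 = `Assembly2`; stmt-11048 = `Assembly`, stmt-6920 = `Assembly22` rank-9
artefacts) — each provable by `exact closes`; operator drop of the two artefact wants requested
(gate refuses planner --drop: 'the assembly item cannot be dropped'; --retriage: 'the assembly item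
cannot be retriaged'; set-signature does not dedup-merge; verified 2026-08-15 g9).

DEFINITION REQUESTS. To shrink later signatures (filed after open, low priority): `conformalWelding`
(Literature/Probability/RandomPlanarGeometry): the
welding homeomorphism x ↦ h(x) of a simple chord of a 4-marked Jordan domain, i.e. the W pinned by
WeldingSetup; `IsRemovableIn Ω K`
(Literature/Analysis or RandomPlanarGeometry): conformal removability of a compact set inside a
planar domain (the inlined ∀ F clause).
Informal engine objects NOT requested as blocking definitions: boundary Gaussian multiplicative
chaos / quantum wedge (would live in
Literature/Probability; only the layer-2 child BankIndependence needs them). Cite facts wanted: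
Rohde–Schramm 2005 Thm 5.2/6.1 and
Jones–Smirnov 2000 (for SLERemovableChord); Sheffield 2016 Thm 1.3–1.4 (engine, not load-bearing in
the typed assembly).

Novelty: Searches (2026-08-15): `lit search --source crossref "conformal welding uniqueness SLE
removability"` (20: McenteggartMillerQian2019,
Sheffield2016, Ang–Holden–Sun loop/multiple-SLE weldings doi:10.1214/23-ejp914 and
doi:10.1007/s00440-025-01425-1, Kavvadias–Miller–Schoug
2026 doi:10.1007/s00222-026-01427-3, Younsi2018 — all continuum); `lit search --source zbmath
"conformal welding SLE lattice scaling
limit"` (2: Miller–Sheffield–Werner simple CLE on LQG arXiv:2002.05698, Sun–Yu arXiv:2309.05177); `…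
zbmath "conformal welding
self-avoiding walk"` (0); `… crossref "random conformal weldings Astala Jones Kupiainen Saksman"`
(AstalaEtAl2011,
KupiainenMcauleySaksman2026 = welding of independent GMC measures); `… crossref "removability
theorems Sobolev quasiconformal Hölder"`
(JonesSmirnov2000); `lit frontier CriticalPhenomena --since 2020` (30; arXiv:2211.15609 SLE
regularity, arXiv:2605.03385 QLE — no lattice
welding); `lit bridges CriticalPhenomena --cross any` (30, none relevant); `lit galaxy search
"conformal welding" --star all` (pdf/panama
queued out today, 1 irrelevant crabby hit; the card's galaxy runs found arXiv:2004.09462,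
2006.13767, 2004.04720, 1603.03362,
1510.04687 — continuum); local searchd index unreachable this session (recorded). Plus the refuter
novelty audit of the card (2026-08-15).
Nearest prior art found: Sheffield2016 (arXiv:1012.4797: SLE_κ, κ = γ² < 4, is the welding seam of
two independent γ-wedges and is
determined by its welding via RohdeSchramm200  [refs: 10.1214/23-ejp914, 10.1007/s00440-025-01425-1, 10.1007/s00222-026-01427-3, 2002.05698, 2309.05177, 2211.15609, 2605.03385, 2004.09462, 1012.4797, doi:10.1214/23-ejp914, doi:10.1007/s00440-025-01425-1, doi:10.1007/s00222-026-01427-3, McenteggartMillerQian2019, Sheffield2016, Younsi2018, AstalaEtAl2011, KupiainenMcauleySaksman2026, JonesSmirnov2000, RohdeSchramm2005, DuplantierMillerSheffield2021]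

Barriers (technique_class: conformal-welding lqg-zipper removability bank-independence): - technique_class: conformal-welding lqg-zipper removability bank-independence
- Literature.Barriers.CriticalPhenomena.EmbeddingModulusUniqueness: respected, not evaded cheaply —
the welding is computed in the EUCLIDEAN conformal structure of the two banks, so on a sheared
lattice the same construction would converge (if at all) to the welding of a linear image of
SLE_{8/3}, which is not the SLE welding law; WeldingLawOfLimit is therefore embedding-specific by
construction and the isotropy of ℤ² must act inside it (the bet: bank independence is where the
quarter-turn symmetry is spent); RemovableLimit and EventualTight are shear-invariant and claim no
symmetry.
- Literature.Barriers.CriticalPhenomena.ScaleCovarianceNotMoebius: not in its class — no symmetry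
upgrade is attempted; conformal covariance is neither hypothesis nor conclusion about the SAW
family; identification runs through removability (WeldingRigidity) and Lusin–Souslin, not through a
covariance-to-Möbius step.
- Literature.Barriers.CriticalPhenomena.SAWNoUnitaryCFT: not triggered — no Virasoro representation,
reflection positivity or bootstrap; LQG/GMC enter only as probability measures in the informal
engine, c = 0 only as "no bank–bank interaction".
- Literature.Barriers.CriticalPhenomena.NienhuisWeightsExcludeVertexSAW: evaded — no
discrete-holomorphic or parafermionic observable and no exact vertex relation on ℤ²; the lattice
quantity behind the welding is two-sided discrete harmonic measure (random-walk hit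

History (route lifecycle, newest last):
- 2026-08-16T14:43:06Z · LINT AUTOFIX route.multi-assembly: kept Assembly, dropped Assembly2, Assembly22 (gate:hygiene)

sub-problem: SAWScalingLimit · status: open · opened planner-plancard-CriticalPhenomena-SAWScaling-35efa213-0 2026-08-15T11:34:22Z · rev 10 · ledger route-CriticalPhenomena-SAWWeldingIdentification
GENERATED by the gate from the ledger (D-0016/17). Provers cite these decls: `theorem foo : Summit.CriticalPhenomena.SAWScalingLimit.Theses.SAWWeldingIdentification.<Decl> := …` in Summits/CriticalPhenomena/SAWScalingLimit/Theorems/<Name>.lean.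
-/

namespace Summit.CriticalPhenomena.SAWScalingLimit.Theses.SAWWeldingIdentification

open scoped BigOperators Topology Manifold Classical MeasureTheory ProbabilityTheory Matrix InnerProductSpace ComplexConjugate ContinuousMap
open Filter Set Function TopologicalSpace MeasureTheory

attribute [summit_statement] _root_.SAWScalingLimit

/-- item stmt-CriticalPhenomena-4502 · crux · rank 2 · open · by planner
why it might fail: Bank independence on ℤ² is conjectural: two-sided harmonic measure of fractal lattice banks needs exponential-moment multifractal control, isotropy (Beffara's modulus) must be spent inside this crux, and the only characterisation engines are GMC shift-covariance / KMS welding uniqueness.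
sources: Sheffield2016, DuplantierMillerSheffield2021, KupiainenMcauleySaksman2026, AstalaEtAl2011, GwynneMiller2021SAW, McenteggartMillerQian2019
[crux] (W) of the card (its W2 ∪ W1 read at the level of limits): for every conformal rectangle Q
(Dobrushin domain Q.chord 0 2 = (Ω; a, b) with auxiliary marks c_L = Q.pt 1, c_R = Q.pt 3), every
endpoint approximation, every probability measure P that is a weak limit of the pushed-forward
critical SAW laws along some δ_n → 0⁺, every welding functional W (pinned on chords by the canonical
uniformisers, measurable) and every chordal SLE_{8/3} random curve Γ in (Ω; a, b): all
finite-dimensional laws of (W Q γ x₁, …, W Q γ x_k), x_i > 0, under P equal those under the law of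
Γ. Engine: the SLE_{8/3} welding is the quotient clock of two independent √(8/3)-LQG boundary
lengths (Sheffield2016; DuplantierMillerSheffield2021 Thm 1.2), so the lattice task is "bank
independence": the two-sided harmonic-measure parametrisations of the walk decouple as quantum
boundary lengths. [difficulty: open-problem] -/
@[route_item "route-CriticalPhenomena-SAWWeldingIdentification", crux]
def WeldingLawOfLimit : Prop :=
  Literature.Probability.RandomPlanarGeometry.IsSLECurve.map_eq → ∀ W : Literature.Probability.RandomPlanarGeometry.ConformalRectangle → Literature.Probability.RandomPlanarGeometry.CurveClass ℂ → ℝ → ℝ, (∀ (Q : Literature.Probability.RandomPlanarGeometry.ConformalRectangle) (γ : (Literature.Probability.RandomPlanarGeometry.CurveClass ℂ)) (s : ℝ) (L R : Set ℂ) (φ : Literature.Probability.RandomPlanarGeometry.ConformalEquiv UpperHalfPlane.upperHalfPlaneSet L) (ψ : Literature.Probability.RandomPlanarGeometry.ConformalEquiv UpperHalfPlane.upperHalfPlaneSet R), (γ ∈ Literature.Probability.RandomPlanarGeometry.CurveClass.simple ∧ γ.source = Q.pt 0 ∧ γ.target = Q.pt 2 ∧ γ.range ⊆ closure Q.carrier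 ∧ γ.range ∩ frontier Q.carrier ⊆ {Q.pt 0, Q.pt 2}) → (s = 1 ∨ s = -1) → (L ∪ R = Q.carrier \ γ.range ∧ Disjoint L R ∧ IsOpen L ∧ IsOpen R ∧ IsConnected L ∧ IsConnected R ∧ Q.pt 1 ∈ closure L ∧ Q.pt 3 ∈ closure R) → (φ.HasBoundaryValue 0 (Q.pt 0) ∧ φ.HasBoundaryValueAtInfty (Q.pt 2) ∧ φ.HasBoundaryValue ((s : ℝ) : ℂ) (Q.pt 1) ∧ ψ.HasBoundaryValue 0 (Q.pt 0) ∧ ψ.HasBoundaryValueAtInfty (Q.pt 2) ∧ ψ.HasBoundaryValue (-((s : ℝ) : ℂ)) (Q.pt 3)) → ∀ x : ℝ, 0 < x → 0 < W Q γ x ∧ ψ.boundaryExtension (((s * x : ℝ)) : ℂ) = φ.boundaryExtension (((-(s * W Q γ x) : ℝ)) : ℂ)) → (∀ (Q : Literature.Probability.RandomPlanarGeometry.ConformalRectangle) (x : ℝ), Measurable fun γ : Literature.Probability.RandomPlanarGeometry.CurveClass ℂ => W Q γ x) → ∀ (Q : Literature.Probability.RandomPlanarGeometry.ConformalRectangle)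 (a b : ℝ → Literature.Probability.LatticeModels.Site 2), Literature.Probability.RandomPlanarGeometry.SAW.IsEndpointApprox (Q.chord 0 2 (by decide)) a b → ∀ (P : MeasureTheory.Measure (Literature.Probability.RandomPlanarGeometry.CurveClass ℂ)), MeasureTheory.IsProbabilityMeasure P → ∀ (δs : ℕ → ℝ), (∀ n, 0 < δs n) → Filter.Tendsto δs Filter.atTop (nhds 0) → (∀ f : BoundedContinuousFunction (Literature.Probability.RandomPlanarGeometry.CurveClass ℂ) ℝ, Filter.Tendsto (fun n => ∫ γ, f γ.curve ∂(Literature.Probability.RandomPlanarGeometry.SAW.law Q.carrier (δs n) (a (δs n)) (b (δs n)))) Filter.atTop (nhds (∫ γ, f γ ∂P))) → ∀ Γ : (NNReal → ℝ) → Literature.Probability.RandomPlanarGeometry.CurveClass ℂ, Literature.Probability.RandomPlanarGeometry.IsSLECurve ((8 : NNReal) / 3) (Q.chord 0 2 (by decide)) Γ → ∀ (k : ℕ) (x : Fin k → ℝ), (∀ i, 0 < x i) → P.map (fun γ i => W Q γ (x i)) = (Literature.Probability.Process.preWienerMeasure.map Γ).map (fun γ i => W Q γ (x i))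

/-- item stmt-CriticalPhenomena-4503 · crux · rank 3 · open · by planner
why it might fail: Needs no-fjord (Hölder/John bank) estimates for the x_c-SAW at all scales under every endpoint approximation; only sub-ballisticity is in print, simplicity of limits is itself open, and non-removable simple limits would make the welding blind (Younsi2018).
sources: JonesSmirnov2000, RohdeSchramm2005, Younsi2018, DuminilCopinHammond2013, KennedyLawler2013, LawlerSchrammWerner2004SAW
[crux] (R) of the card: for every conformal rectangle Q, endpoint approximation and subsequential
weak limit P of the critical SAW laws (as in WeldingLawOfLimit), P-almost every curve is a simple
chord of (Ω; a, b) (simple, from a to b, meeting ∂Ω only at a, b) that is conformally removable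
inside Ω: every continuous injective self-map of Ω onto Ω that is holomorphic off the curve is
holomorphic on Ω. Intended engine: uniform Hölder/John estimates for the two banks of the walk (no
fjords at any scale) and the Jones–Smirnov removability of Hölder-domain boundaries. [difficulty:
XL] -/
@[route_item "route-CriticalPhenomena-SAWWeldingIdentification", crux]
def RemovableLimit : Prop :=
  ∀ (Q : Literature.Probability.RandomPlanarGeometry.ConformalRectangle) (a b : ℝ → Literature.Probability.LatticeModels.Site 2), Literature.Probability.RandomPlanarGeometry.SAW.IsEndpointApprox (Q.chord 0 2 (by decide)) a b → ∀ (P : MeasureTheory.Measure (Literature.Probability.RandomPlanarGeometry.CurveClass ℂ)), MeasureTheory.IsProbabilityMeasure P → ∀ (δs : ℕ → ℝ), (∀ n, 0 < δs n) → Filter.Tendsto δs Filter.atTop (nhds 0) → (∀ f : BoundedContinuousFunction (Literature.Probability.RandomPlanarGeometry.CurveClass ℂ) ℝ, Filter.Tendsto (fun n => ∫ γ, f γ.curve ∂(Literature.Probability.RandomPlanarGeometry.SAW.law Q.carrier (δs n) (a (δs n)) (b (δs n)))) Filter.atTop (nhds (∫ γ, f γ ∂P))) → ∀ᵐ γ ∂P,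 (γ ∈ Literature.Probability.RandomPlanarGeometry.CurveClass.simple ∧ γ.source = Q.pt 0 ∧ γ.target = Q.pt 2 ∧ γ.range ⊆ closure Q.carrier ∧ γ.range ∩ frontier Q.carrier ⊆ {Q.pt 0, Q.pt 2}) ∧ (∀ F : ℂ → ℂ, ContinuousOn F Q.carrier → Set.InjOn F Q.carrier → F '' Q.carrier = Q.carrier → DifferentiableOn ℂ F (Q.carrier \ γ.range) → DifferentiableOn ℂ F Q.carrier)

/-- item stmt-CriticalPhenomena-1372 · crux · rank 4 · SPLIT (gen 1) into VirginArcTraversalTightBounded, ConfinementPositivity + glue Summit.CriticalPhenomena.SAWScalingLimit.Theorems.eventualTight_of_virginArcTraversalTightBounded_of_confinementPositivity · direct attempts still welcome (low priority) · by planner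
why it might fail: Eventual tightness of the critical SAW is open: no annulus multi-crossing bound (KS Condition G2, AB99 hypothesis H1) is known at x_c on ℤ²; only sub-ballisticity (DCH13) and hexagonal quantitative bounds are in print.
sources: KemppainenSmirnov2017, AizenmanBurchardDuke1999, DuminilCopinHammond2013, arXiv:2310.17299
[support] eventual tightness of the pushed-forward critical SAW laws: for every Dobrushin domain and
endpoint approximation there is δ₀ > 0 such that {(law D δ a_δ b_δ).map curve : δ ∈ (0, δ₀]} is a
tight set of measures on CurveClass ℂ — the repaired (∃ δ₀) form of the refuted all-δ statement
stmt-CriticalPhenomena-0772 suggested by its refutation; child-designate of LimitExists, shared need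
of every SAW route. Intended tools: Aizenman–Burchard / Kemppainen–Smirnov Condition G2 (an
annulus-crossing bound at x_c not in print). Sources: KemppainenSmirnov2017 Thm 1.5,
AizenmanBurchardDuke1999, DuminilCopinHammond2013. -/
@[route_item "route-CriticalPhenomena-SAWWeldingIdentification", crux]
def EventualTight : Prop :=
  ∀ (D : Literature.Probability.RandomPlanarGeometry.DobrushinDomain) (a b : ℝ → Literature.Probability.LatticeModels.Site 2), Literature.Probability.RandomPlanarGeometry.SAW.IsEndpointApprox D a b → ∃ δ₀ : ℝ, 0 < δ₀ ∧ MeasureTheory.IsTightMeasureSet ((fun δ => (Literature.Probability.RandomPlanarGeometry.SAW.law D.carrier δ (a δ) (b δ)).map (fun γ => γ.curve)) '' Set.Ioc 0 δ₀)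

-- parent: EventualTight · child (gen 1)
/--     item stmt-CriticalPhenomena-18042 · crux · rank 401 · open
    parent: EventualTight · by operator
    why it might fail: Research-open: an annulus multi-crossing bound for the critical Z^2 SAW uniform over exteriors is KS Condition G2 at one shape; no FKG/BK/RSW, no Z^2 observable, G_{x_c}(0,e1)<infty open; an entropic finite exterior could in principle reward deep re-entries (none found, c5-c7).
    sources: KemppainenSmirnov2017, AizenmanBurchardDuke1999, DuminilCopinSmirnov2012, MadrasSlade1993, DuminilCopinHammond2013
[crux] THE BULK ATOM IN ITS WEAKEST CONSUMED FORM X2c1b (bounded-exterior virgin-arc traversal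
tightness): for every C and every theta>0 there are k, N0 such that for every FINITE exterior
configuration (H <= Z^2, Lambda finite, Lambda inside the closed disc of radius C*N) that is virgin
in the closed lattice disc B(z0,N) (every lattice point of the disc allowed, every lattice edge of
B(z0,N+1) an H-edge), N >= N0, and every two rim doors (u,c), (u',c'), the x_c-mass of self-avoiding
H-arcs c -> c' in Lambda whose vertex sequence makes k weak traversals of the annulus D(z0; 2N/5,
3N/5) is <= theta * (mass of all such arcs). = Kemppainen-Smirnov Condition G2 for the critical Z^2
SAW arc measure at ONE annulus shape inside a finite planar graph of comparable diameter. VERBATIM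
the registered open stub stub_virginArcTraversalTightBounded of stmt-1372's live skeleton Sketch v9
(leads c6-c8), so one proof closes both; strictly WEAKER than item stmt-CriticalPhenomena-17940
(unbounded exteriors) by the landed Theorems.virginArcTraversalTightBounded_of_finite (p151500), and
the form every consumer needs (leads c6 sec.1, c7 Rec.1: 'file X2c1b as THE bulk research item').
With ConfinementPos -/
@[route_item "route-CriticalPhenomena-SAWWeldingIdentification", crux]
def VirginArcTraversalTightBounded : Prop :=
  ∀ C θ : ℝ, 0 < θ → ∃ (k : ℕ) (N₀ : ℝ), 0 < N₀ ∧ ∀ (H : SimpleGraph (Literature.Probability.LatticeModels.Site 2)) (Λ : Set (Literature.Probability.LatticeModels.Site 2)) (z₀ : ℂ) (N : ℝ) (u c u' c' : Literature.Probability.LatticeModels.Site 2), Λ.Finite → (∀ v ∈ Λ, dist (Literature.Probability.LatticeModels.Site.toComplex v) z₀ ≤ C * N) → N₀ ≤ N → (H ≤ Literature.Probability.LatticeModels.zdGraph 2 ∧ (∀ v : Literature.Probability.LatticeModels.Site 2, dist (Literature.Probability.LatticeModels.Site.toComplex v) z₀ ≤ N → v ∈ Λ) ∧ ∀ v v' :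 Literature.Probability.LatticeModels.Site 2, dist (Literature.Probability.LatticeModels.Site.toComplex v) z₀ ≤ N + 1 → dist (Literature.Probability.LatticeModels.Site.toComplex v') z₀ ≤ N + 1 → (Literature.Probability.LatticeModels.zdGraph 2).Adj v v' → H.Adj v v') → (H.Adj u c ∧ u ∉ Λ ∧ c ∈ Λ ∧ dist (Literature.Probability.LatticeModels.Site.toComplex c) z₀ ≤ N ∧ N < dist (Literature.Probability.LatticeModels.Site.toComplex u) z₀) → (H.Adj u' c' ∧ u' ∉ Λ ∧ c' ∈ Λ ∧ dist (Literature.Probability.LatticeModels.Site.toComplex c') z₀ ≤ N ∧ N < dist (Literature.Probability.LatticeModels.Site.toComplex u') z₀) → ∑' p : {p : {p : H.Walk c c' // p.IsPath ∧ ∀ v ∈ p.support, v ∈ Λ} // ∃ ι κ : Fin k → Fin (p.1.support.map Literature.Probability.LatticeModels.Site.toComplex).length, (∀ m, ι m ≤ κ m) ∧ (∀ m, (dist ((p.1.support.map Literature.Probability.LatticeModels.Site.toComplex).get (ι m)) z₀ ≤ 2 * N / 5 ∧ 3 * N / 5 ≤ dist ((p.1.support.map Literature.Probability.LatticeModels.Site.toComplex).get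 (κ m)) z₀) ∨ (3 * N / 5 ≤ dist ((p.1.support.map Literature.Probability.LatticeModels.Site.toComplex).get (ι m)) z₀ ∧ dist ((p.1.support.map Literature.Probability.LatticeModels.Site.toComplex).get (κ m)) z₀ ≤ 2 * N / 5)) ∧ ∀ ⦃m m'⦄, m < m' → κ m ≤ ι m'}, ENNReal.ofReal (Literature.Probability.RandomPlanarGeometry.SAW.criticalFugacity ^ p.1.1.length) ≤ ENNReal.ofReal θ * ∑' p : {p : H.Walk c c' // p.IsPath ∧ ∀ v ∈ p.support, v ∈ Λ}, ENNReal.ofReal (Literature.Probability.RandomPlanarGeometry.SAW.criticalFugacity ^ p.1.length)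

-- parent: EventualTight · child (gen 1)
/--     item stmt-CriticalPhenomena-17587 · crux · rank 402 · open
    parent: EventualTight · by operator
    why it might fail: No RSW-type lower bound for the critical SAW is in print on any planar lattice; E contains limsup_W W*m_W(x_c) < infty on tube pairs (strip hyperscaling), whose only known source is the scaling limit itself.
    sources: LawlerSchrammWerner2004SAW, DuminilCopinSmirnov2012, KemppainenSmirnov2017, DuminilCopinHammond2013
[crux] restriction positivity (the SAW box-crossing property): for nested Dobrushin domains D' ⊆ D
with the same marked points and sockets D ∩ (B(a,d) ∪ B(b,d)) ⊆ D', and every endpoint approximation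
of D', the critical SAW of D_δ from a_δ to b_δ is a D'_δ-walk with probability ≥ c > 0 for all δ ∈
(0, δ₀]. Equivalent to liminf_δ Z_{D'}(a_δ,b_δ)/Z_D(a_δ,b_δ) > 0
(Theorems.confinementPositivity_iff_partitionRatio, p103341); implied by SAWScalingLimit
(Theorems.confinementPositivity_of_scalingLimit, p105757), so summit-safe; monotone in nested
quadruples (Theorems.confinementRatio_mono, p139226), hence reducible to standard pairs (tube inside
an enlargement). Verbatim the registered stub stub_confinementPositivity of lines Sketch v5
(stmt-1372) and confinement-bulk-tightness (stmt-4728). Numerics: Z_{D'}/Z_D ≈ 0.6–0.7 flat in δ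
(PERM j012789, Cruxes/ShellCrossingBound/ToyDataIdeator2.md). -/
@[route_item "route-CriticalPhenomena-SAWWeldingIdentification", crux]
def ConfinementPositivity : Prop :=
  ∀ (D D' : Literature.Probability.RandomPlanarGeometry.DobrushinDomain) (a b : ℝ → Literature.Probability.LatticeModels.Site 2) (d : ℝ), 0 < d → D'.carrier ⊆ D.carrier → D'.pt 0 = D.pt 0 → D'.pt 1 = D.pt 1 → D.carrier ∩ (Metric.ball (D.pt 0) d ∪ Metric.ball (D.pt 1) d) ⊆ D'.carrier → Literature.Probability.RandomPlanarGeometry.SAW.IsEndpointApprox D' a b → ∃ c δ₀ : ℝ, 0 < c ∧ 0 < δ₀ ∧ ∀ δ ∈ Set.Ioc (0 : ℝ) δ₀, ENNReal.ofReal c ≤ Literature.Probability.RandomPlanarGeometry.SAW.law D.carrier δ (a δ) (b δ) {γ | ∃ γ' : Literature.Probability.RandomPlanarGeometry.SAW.DomainSAW D'.carrier δ (a δ) (b δ), γ'.walk.support = γ.walk.support}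

/-- glue for the split of `EventualTight`: landed theorem `Summit.CriticalPhenomena.SAWScalingLimit.Theorems.eventualTight_of_virginArcTraversalTightBounded_of_confinementPositivity`. -/
theorem EventualTightGlueBy_holds : VirginArcTraversalTightBounded → ConfinementPositivity → EventualTight := _root_.Summit.CriticalPhenomena.SAWScalingLimit.Theorems.eventualTight_of_virginArcTraversalTightBounded_of_confinementPositivity

/-- item stmt-CriticalPhenomena-11091 · support · rank 9 · closed · proved by Summit.CriticalPhenomena.SAWScalingLimit.Theorems.identifyFromWeldingAE_proof @ 657f3200cf4f (prover) · by planner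
[support] identification from the welding law, INNER (Wiener-space a.e.) form — route-repair g5,
supersedes IdentifyFromWelding (stmt-CriticalPhenomena-4507) and the obsolete assembly sibling
Assembly2 (stmt-CriticalPhenomena-6920): for a conformal rectangle Q, a welding functional W (Borel
in γ for each (Q, x)), a probability measure P on CurveClass ℂ and a random curve Γ on the Wiener
space (AEMeasurable, law μ = preWienerMeasure.map Γ a probability measure): if P-almost every curve
and preWienerMeasure-almost every Γ ω are conformally removable simple chords of (Ω; a, b) = Q.chord
0 2, W separates removable simple chords through its values at positive rationals, and all
finite-dimensional W-marginals of P and μ at positive rational points agree, then P = μ. WHY THE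
RESTATEMENT: the outer form (μ-a.e. on curve space) cannot be fed from SLERemovableChord (a.e. on
the Wiener space) without Borel-measurability of the removable-chord set (a coanalytic condition),
so the old interface SLERemovableChord → IdentifyFromWelding was not composable; this inner form is
exactly what the deciding theorem `closes` consumes. PROOF SKETCH (provable now): T ⊆ good, Borel,
P(T) = 1 (from the P-a.e. -/
@[route_item "route-CriticalPhenomena-SAWWeldingIdentification"]
def IdentifyFromWeldingAE : Prop :=
  ∀ (Q : Literature.Probability.RandomPlanarGeometry.ConformalRectangle) (W : Literature.Probability.RandomPlanarGeometry.ConformalRectangle → Literature.Probability.RandomPlanarGeometry.CurveClass ℂ → ℝ → ℝ) (P : MeasureTheory.Measure (Literature.Probability.RandomPlanarGeometry.CurveClass ℂ)) (Γ : (NNReal → ℝ) → Literature.Probability.RandomPlanarGeometry.CurveClass ℂ), MeasureTheory.IsProbabilityMeasure P → MeasureTheory.IsProbabilityMeasure (Literature.Probability.Process.preWienerMeasure.map Γ) → AEMeasurable Γ Literature.Probability.Process.preWienerMeasure → (∀ (Q : Literature.Probability.RandomPlanarGeometry.ConformalRectangle) (x : ℝ), Measurable fun γ : Literature.Probability.RandomPlanarGeometry.CurveClass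 ℂ => W Q γ x) → (∀ᵐ γ ∂P, ((γ ∈ Literature.Probability.RandomPlanarGeometry.CurveClass.simple ∧ γ.source = Q.pt 0 ∧ γ.target = Q.pt 2 ∧ γ.range ⊆ closure Q.carrier ∧ γ.range ∩ frontier Q.carrier ⊆ {Q.pt 0, Q.pt 2}) ∧ (∀ F : ℂ → ℂ, ContinuousOn F Q.carrier → Set.InjOn F Q.carrier → F '' Q.carrier = Q.carrier → DifferentiableOn ℂ F (Q.carrier \ γ.range) → DifferentiableOn ℂ F Q.carrier))) → (∀ᵐ ω ∂Literature.Probability.Process.preWienerMeasure, (((Γ ω) ∈ Literature.Probability.RandomPlanarGeometry.CurveClass.simple ∧ (Γ ω).source = Q.pt 0 ∧ (Γ ω).target = Q.pt 2 ∧ (Γ ω).range ⊆ closure Q.carrier ∧ (Γ ω).range ∩ frontier Q.carrier ⊆ {Q.pt 0, Q.pt 2}) ∧ (∀ F : ℂ → ℂ, ContinuousOn F Q.carrier → Set.InjOn F Q.carrier → F '' Q.carrier = Q.carrier → DifferentiableOn ℂ F (Q.carrier \ (Γ ω).range) → DifferentiableOn ℂ F Q.carrier))) → (∀ γ γ' :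 Literature.Probability.RandomPlanarGeometry.CurveClass ℂ, ((γ ∈ Literature.Probability.RandomPlanarGeometry.CurveClass.simple ∧ γ.source = Q.pt 0 ∧ γ.target = Q.pt 2 ∧ γ.range ⊆ closure Q.carrier ∧ γ.range ∩ frontier Q.carrier ⊆ {Q.pt 0, Q.pt 2}) ∧ (∀ F : ℂ → ℂ, ContinuousOn F Q.carrier → Set.InjOn F Q.carrier → F '' Q.carrier = Q.carrier → DifferentiableOn ℂ F (Q.carrier \ γ.range) → DifferentiableOn ℂ F Q.carrier)) → ((γ' ∈ Literature.Probability.RandomPlanarGeometry.CurveClass.simple ∧ γ'.source = Q.pt 0 ∧ γ'.target = Q.pt 2 ∧ γ'.range ⊆ closure Q.carrier ∧ γ'.range ∩ frontier Q.carrier ⊆ {Q.pt 0, Q.pt 2}) ∧ (∀ F : ℂ → ℂ, ContinuousOn F Q.carrier → Set.InjOn F Q.carrier → F '' Q.carrier = Q.carrier → DifferentiableOn ℂ F (Q.carrier \ γ'.range) → DifferentiableOn ℂ F Q.carrier)) → (∀ q : ℚ, 0 < q → W Q γ q = W Q γ' q) → γ = γ') → (∀ (k : ℕ) (x : Fin k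 → ℚ), (∀ i, 0 < x i) → P.map (fun γ i => W Q γ (x i)) = (Literature.Probability.Process.preWienerMeasure.map Γ).map (fun γ i => W Q γ (x i))) → P = Literature.Probability.Process.preWienerMeasure.map Γ

/-- item stmt-CriticalPhenomena-4504 · support · rank 9 · closed · proved by Summit.CriticalPhenomena.SAWScalingLimit.Theorems.WeldingSetup_proof @ 5d0324c14724 (prover) · by planner
sources: AhlforsCA1979, PommerenkeBBCM1992, Newman1939
[support] the welding is well defined: (i) for every conformal rectangle Q there is a sign s = ±1
(the orientation of the boundary loop) such that every simple chord γ of (Ω; a, b) has banks L, R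
(the two components of Ω ∖ γ, Newman's cross-cut theorem, with c_L ∈ cl L, c_R ∈ cl R) and
normalised uniformisers φ : ℍ → L (0 ↦ a, ∞ ↦ b, s ↦ c_L), ψ : ℍ → R (0 ↦ a, ∞ ↦ b, −s ↦ c_R)
(Riemann mapping + Carathéodory + three-point normalisation); (ii) there is a welding functional W :
Q ↦ γ ↦ (x ↦ h(x)), Borel in γ for each (Q, x), with h(x) > 0 and ψ(s x) = φ(−s h(x)) for every
chord, every such configuration and every x > 0 (uniqueness of normalised uniformisers makes h
configuration-independent; measurability via WeldingContinuity on the Borel set of chords).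
[difficulty: L] -/
@[route_item "route-CriticalPhenomena-SAWWeldingIdentification", crux]
def WeldingSetup : Prop :=
  (∀ (Q : Literature.Probability.RandomPlanarGeometry.ConformalRectangle), ∃ s : ℝ, (s = 1 ∨ s = -1) ∧ ∀ (γ : (Literature.Probability.RandomPlanarGeometry.CurveClass ℂ)), (γ ∈ Literature.Probability.RandomPlanarGeometry.CurveClass.simple ∧ γ.source = Q.pt 0 ∧ γ.target = Q.pt 2 ∧ γ.range ⊆ closure Q.carrier ∧ γ.range ∩ frontier Q.carrier ⊆ {Q.pt 0, Q.pt 2}) → ∃ (L R : Set ℂ) (φ : Literature.Probability.RandomPlanarGeometry.ConformalEquiv UpperHalfPlane.upperHalfPlaneSet L) (ψ : Literature.Probability.RandomPlanarGeometry.ConformalEquiv UpperHalfPlane.upperHalfPlaneSet R), (L ∪ R = Q.carrier \ γ.range ∧ Disjoint L R ∧ IsOpen L ∧ IsOpen R ∧ IsConnected L ∧ IsConnected R ∧ Q.pt 1 ∈ closure L ∧ Q.pt 3 ∈ closure R) ∧ (φ.HasBoundaryValue 0 (Q.pt 0) ∧ φ.HasBoundaryValueAtInfty (Q.pt 2) ∧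 φ.HasBoundaryValue ((s : ℝ) : ℂ) (Q.pt 1) ∧ ψ.HasBoundaryValue 0 (Q.pt 0) ∧ ψ.HasBoundaryValueAtInfty (Q.pt 2) ∧ ψ.HasBoundaryValue (-((s : ℝ) : ℂ)) (Q.pt 3))) ∧ ∃ W : Literature.Probability.RandomPlanarGeometry.ConformalRectangle → Literature.Probability.RandomPlanarGeometry.CurveClass ℂ → ℝ → ℝ, (∀ (Q : Literature.Probability.RandomPlanarGeometry.ConformalRectangle) (x : ℝ), Measurable fun γ : Literature.Probability.RandomPlanarGeometry.CurveClass ℂ => W Q γ x) ∧ (∀ (Q : Literature.Probability.RandomPlanarGeometry.ConformalRectangle) (γ : (Literature.Probability.RandomPlanarGeometry.CurveClass ℂ)) (s : ℝ) (L R : Set ℂ) (φ : Literature.Probability.RandomPlanarGeometry.ConformalEquiv UpperHalfPlane.upperHalfPlaneSet L) (ψ : Literature.Probability.RandomPlanarGeometry.ConformalEquiv UpperHalfPlane.upperHalfPlaneSet R), (γ ∈ Literature.Probability.RandomPlanarGeometry.CurveClass.simple ∧ γ.source = Q.pt 0 ∧ γ.target = Q.pt 2 ∧ γ.range ⊆ closure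 Q.carrier ∧ γ.range ∩ frontier Q.carrier ⊆ {Q.pt 0, Q.pt 2}) → (s = 1 ∨ s = -1) → (L ∪ R = Q.carrier \ γ.range ∧ Disjoint L R ∧ IsOpen L ∧ IsOpen R ∧ IsConnected L ∧ IsConnected R ∧ Q.pt 1 ∈ closure L ∧ Q.pt 3 ∈ closure R) → (φ.HasBoundaryValue 0 (Q.pt 0) ∧ φ.HasBoundaryValueAtInfty (Q.pt 2) ∧ φ.HasBoundaryValue ((s : ℝ) : ℂ) (Q.pt 1) ∧ ψ.HasBoundaryValue 0 (Q.pt 0) ∧ ψ.HasBoundaryValueAtInfty (Q.pt 2) ∧ ψ.HasBoundaryValue (-((s : ℝ) : ℂ)) (Q.pt 3)) → ∀ x : ℝ, 0 < x → 0 < W Q γ x ∧ ψ.boundaryExtension (((s * x : ℝ)) : ℂ) = φ.boundaryExtension (((-(s * W Q γ x) : ℝ)) : ℂ))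

/-- item stmt-CriticalPhenomena-4505 · support · rank 9 · closed · proved by Summit.CriticalPhenomena.SAWScalingLimit.Theorems.WeldingRigidity.weldingRigidity_proof (prover) · by planner
sources: JonesSmirnov2000, Sheffield2016, McenteggartMillerQian2019, PommerenkeBBCM1992
[support] a removable chord is determined by its welding: if γ, γ' are simple chords of (Ω; a, b), γ
conformally removable inside Ω, with banks and normalised uniformisers (φ, ψ), (φ', ψ') for the same
sign s, and a common welding on the positive rationals (h(q) > 0, ψ(s q) = φ(−s h q) and ψ'(s q) =
φ'(−s h q) for all rational q > 0), then γ = γ'. Proof sketch: F := φ'∘φ⁻¹ on L, ψ'∘ψ⁻¹ on R extends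
across γ (the two boundary correspondences agree on the dense set ψ(sℚ₊)) to a continuous bijection
Ω → Ω holomorphic off γ, hence (removability) a conformal automorphism of Ω fixing the three
boundary points a, b, c_L, hence the identity. Classical: JonesSmirnov2000 §1, Sheffield2016 §1.4
(welding uniqueness), Carathéodory boundary correspondence. [difficulty: M] -/
@[route_item "route-CriticalPhenomena-SAWWeldingIdentification", crux]
def WeldingRigidity : Prop :=
  ∀ (Q : Literature.Probability.RandomPlanarGeometry.ConformalRectangle) (γ γ' : (Literature.Probability.RandomPlanarGeometry.CurveClass ℂ)) (s : ℝ) (L R L' R' : Set ℂ) (φ : Literature.Probability.RandomPlanarGeometry.ConformalEquiv UpperHalfPlane.upperHalfPlaneSet L) (ψ : Literature.Probability.RandomPlanarGeometry.ConformalEquiv UpperHalfPlane.upperHalfPlaneSet R) (φ' : Literature.Probability.RandomPlanarGeometry.ConformalEquiv UpperHalfPlane.upperHalfPlaneSet L') (ψ' : Literature.Probability.RandomPlanarGeometry.ConformalEquiv UpperHalfPlane.upperHalfPlaneSet R') (h : ℚ → ℝ), (γ ∈ Literature.Probability.RandomPlanarGeometry.CurveClass.simple ∧ γ.source = Q.pt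 0 ∧ γ.target = Q.pt 2 ∧ γ.range ⊆ closure Q.carrier ∧ γ.range ∩ frontier Q.carrier ⊆ {Q.pt 0, Q.pt 2}) → (γ' ∈ Literature.Probability.RandomPlanarGeometry.CurveClass.simple ∧ γ'.source = Q.pt 0 ∧ γ'.target = Q.pt 2 ∧ γ'.range ⊆ closure Q.carrier ∧ γ'.range ∩ frontier Q.carrier ⊆ {Q.pt 0, Q.pt 2}) → (∀ F : ℂ → ℂ, ContinuousOn F Q.carrier → Set.InjOn F Q.carrier → F '' Q.carrier = Q.carrier → DifferentiableOn ℂ F (Q.carrier \ γ.range) → DifferentiableOn ℂ F Q.carrier) → (s = 1 ∨ s = -1) → (L ∪ R = Q.carrier \ γ.range ∧ Disjoint L R ∧ IsOpen L ∧ IsOpen R ∧ IsConnected L ∧ IsConnected R ∧ Q.pt 1 ∈ closure L ∧ Q.pt 3 ∈ closure R) → (L' ∪ R' = Q.carrier \ γ'.range ∧ Disjoint L' R' ∧ IsOpen L' ∧ IsOpen R' ∧ IsConnected L' ∧ IsConnected R' ∧ Q.pt 1 ∈ closure L' ∧ Q.pt 3 ∈ closure R') → (φ.HasBoundaryValue 0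 (Q.pt 0) ∧ φ.HasBoundaryValueAtInfty (Q.pt 2) ∧ φ.HasBoundaryValue ((s : ℝ) : ℂ) (Q.pt 1) ∧ ψ.HasBoundaryValue 0 (Q.pt 0) ∧ ψ.HasBoundaryValueAtInfty (Q.pt 2) ∧ ψ.HasBoundaryValue (-((s : ℝ) : ℂ)) (Q.pt 3)) → (φ'.HasBoundaryValue 0 (Q.pt 0) ∧ φ'.HasBoundaryValueAtInfty (Q.pt 2) ∧ φ'.HasBoundaryValue ((s : ℝ) : ℂ) (Q.pt 1) ∧ ψ'.HasBoundaryValue 0 (Q.pt 0) ∧ ψ'.HasBoundaryValueAtInfty (Q.pt 2) ∧ ψ'.HasBoundaryValue (-((s : ℝ) : ℂ)) (Q.pt 3)) → (∀ q : ℚ, 0 < q → 0 < h q ∧ ψ.boundaryExtension (((s * (q : ℝ) : ℝ)) : ℂ) = φ.boundaryExtension (((-(s * h q) : ℝ)) : ℂ) ∧ ψ'.boundaryExtension (((s * (q : ℝ) : ℝ)) : ℂ) = φ'.boundaryExtension (((-(s * h q) : ℝ)) : ℂ)) → γ = γ'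

/-- item stmt-CriticalPhenomena-4506 · support · rank 9 · closed · proved by Summit.CriticalPhenomena.SAWScalingLimit.Theorems.SLERemovableChord_proof (prover) · by planner
sources: RohdeSchramm2005, JonesSmirnov2000, Sheffield2016, arXiv:2211.15609
[support] Literature fact wanted: for every conformal rectangle Q and every chordal SLE_{8/3} random
curve Γ in (Ω; a, b) = Q.chord 0 2, almost surely Γ is a simple chord of (Ω; a, b) meeting ∂Ω only
at a, b (Rohde–Schramm 2005 Thm 6.1: SLE_κ simple and off the boundary for κ ≤ 4) which is
conformally removable inside Ω (Rohde–Schramm 2005 Thm 5.2: complements of SLE_κ hulls, κ ≠ 4, are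
Hölder domains; Jones–Smirnov 2000: Hölder-domain boundaries are removable for (quasi)conformal
homeomorphisms, a local, conformally invariant property — the form used by Sheffield2016 §1.4).
Expected to close by vendoring these facts; the local-vs-global removability bookkeeping is the one
point to audit. [difficulty: M] -/
@[route_item "route-CriticalPhenomena-SAWWeldingIdentification", crux]
def SLERemovableChord : Prop :=
  ∀ (Q : Literature.Probability.RandomPlanarGeometry.ConformalRectangle) (Γ : (NNReal → ℝ) → Literature.Probability.RandomPlanarGeometry.CurveClass ℂ), Literature.Probability.RandomPlanarGeometry.IsSLECurve ((8 : NNReal) / 3) (Q.chord 0 2 (by decide)) Γ → ∀ᵐ ω ∂Literature.Probability.Process.preWienerMeasure, ((Γ ω) ∈ Literature.Probability.RandomPlanarGeometry.CurveClass.simple ∧ (Γ ω).source = Q.pt 0 ∧ (Γ ω).target = Q.pt 2 ∧ (Γ ω).range ⊆ closure Q.carrier ∧ (Γ ω).range ∩ frontier Q.carrier ⊆ {Q.pt 0, Q.pt 2}) ∧ (∀ F : ℂ → ℂ, ContinuousOn F Q.carrier → Set.InjOn F Q.carrier → F '' Q.carrier = Q.carrier → DifferentiableOn ℂ F (Q.carrier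 \ (Γ ω).range) → DifferentiableOn ℂ F Q.carrier)

/-- item stmt-CriticalPhenomena-4507 · support · rank 9 · closed · proved by Summit.CriticalPhenomena.SAWScalingLimit.Theorems.identifyFromWelding_proof (prover) · by planner
sources: Billingsley1999, AizenmanBurchard1999
[support] measure-theoretic glue (Lusin–Souslin): two probability measures P, μ on CurveClass ℂ,
each carried (a.e.) by removable simple chords of (Ω; a, b), on which a measurable welding
functional W separates points through its values at positive rationals, and whose finite-dimensional
W-marginals at positive rational points coincide, are equal. Proof: a.e. ⇒ measurable full-measure
subsets of the removable chords; γ ↦ (W Q γ q)_q is a measurable injection of their union into ℝ^ℕ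
(Polish), so images of Borel sets are Borel (Mathlib MeasurableSet.image_of_measurable_injOn) and
P(A) = P∘V⁻¹(V(A ∩ T)) = μ∘V⁻¹(V(A ∩ T)) = μ(A), the laws of V agreeing by the π-system of
cylinders. [difficulty: provable-now] -/
@[route_item "route-CriticalPhenomena-SAWWeldingIdentification", crux]
def IdentifyFromWelding : Prop :=
  ∀ (Q : Literature.Probability.RandomPlanarGeometry.ConformalRectangle) (W : Literature.Probability.RandomPlanarGeometry.ConformalRectangle → Literature.Probability.RandomPlanarGeometry.CurveClass ℂ → ℝ → ℝ) (P : MeasureTheory.Measure (Literature.Probability.RandomPlanarGeometry.CurveClass ℂ)) (Ω' : Type) [MeasurableSpace Ω'] (μ' : MeasureTheory.Measure Ω') (Γ : Ω' → Literature.Probability.RandomPlanarGeometry.CurveClass ℂ), MeasureTheory.IsProbabilityMeasure P → MeasureTheory.IsProbabilityMeasure μ' → AEMeasurable Γ μ' → (∀ (Q : Literature.Probability.RandomPlanarGeometry.ConformalRectangle) (x : ℝ), Measurable fun γ : Literature.Probability.RandomPlanarGeometry.CurveClass ℂ => W Q γ x) → (∀ᵐ γ ∂P, ((γ ∈ Literature.Probability.RandomPlanarGeometry.CurveClass.simple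 ∧ γ.source = Q.pt 0 ∧ γ.target = Q.pt 2 ∧ γ.range ⊆ closure Q.carrier ∧ γ.range ∩ frontier Q.carrier ⊆ {Q.pt 0, Q.pt 2}) ∧ (∀ F : ℂ → ℂ, ContinuousOn F Q.carrier → Set.InjOn F Q.carrier → F '' Q.carrier = Q.carrier → DifferentiableOn ℂ F (Q.carrier \ γ.range) → DifferentiableOn ℂ F Q.carrier))) → (∀ᵐ ω ∂μ', (((Γ ω) ∈ Literature.Probability.RandomPlanarGeometry.CurveClass.simple ∧ (Γ ω).source = Q.pt 0 ∧ (Γ ω).target = Q.pt 2 ∧ (Γ ω).range ⊆ closure Q.carrier ∧ (Γ ω).range ∩ frontier Q.carrier ⊆ {Q.pt 0, Q.pt 2}) ∧ (∀ F : ℂ → ℂ, ContinuousOn F Q.carrier → Set.InjOn F Q.carrier → F '' Q.carrier = Q.carrier → DifferentiableOn ℂ F (Q.carrier \ (Γ ω).range) → DifferentiableOn ℂ F Q.carrier))) → (∀ γ γ' : Literature.Probability.RandomPlanarGeometry.CurveClass ℂ, ((γ ∈ Literature.Probability.RandomPlanarGeometry.CurveClass.simple ∧ γ.source = Q.pt 0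 ∧ γ.target = Q.pt 2 ∧ γ.range ⊆ closure Q.carrier ∧ γ.range ∩ frontier Q.carrier ⊆ {Q.pt 0, Q.pt 2}) ∧ (∀ F : ℂ → ℂ, ContinuousOn F Q.carrier → Set.InjOn F Q.carrier → F '' Q.carrier = Q.carrier → DifferentiableOn ℂ F (Q.carrier \ γ.range) → DifferentiableOn ℂ F Q.carrier)) → ((γ' ∈ Literature.Probability.RandomPlanarGeometry.CurveClass.simple ∧ γ'.source = Q.pt 0 ∧ γ'.target = Q.pt 2 ∧ γ'.range ⊆ closure Q.carrier ∧ γ'.range ∩ frontier Q.carrier ⊆ {Q.pt 0, Q.pt 2}) ∧ (∀ F : ℂ → ℂ, ContinuousOn F Q.carrier → Set.InjOn F Q.carrier → F '' Q.carrier = Q.carrier → DifferentiableOn ℂ F (Q.carrier \ γ'.range) → DifferentiableOn ℂ F Q.carrier)) → (∀ q : ℚ, 0 < q → W Q γ q = W Q γ' q) → γ = γ') → (∀ (k : ℕ) (x : Fin k → ℚ), (∀ i, 0 < x i) → P.map (fun γ i => W Q γ (x i)) = (μ'.map Γ).map (fun γ i => W Q γ (x i))) → P = μ'.map Γ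

/-- item stmt-CriticalPhenomena-4508 · support · rank 9 · closed · proved by Summit.CriticalPhenomena.SAWScalingLimit.Theorems.limitUpgrade_proof (prover) · by planner
sources: Billingsley1999, AizenmanBurchardDuke1999
[support] weak-convergence glue (Prokhorov): if the pushed-forward SAW laws of (D; a_δ, b_δ) are
eventually tight and every probability measure arising as their weak limit along a sequence δ_n → 0⁺
equals μ, then they converge to μ along 𝓝[>]0 in the sense TendstoLaw (target r.v. id). Proof:
otherwise some bounded continuous f and δ_n → 0 keep |∫ f dlaw_n − ∫ f dμ| ≥ ε; eventual tightness
and Mathlib's Prokhorov theorem (isCompact_closure_of_isTightMeasureSet, Lévy–Prokhorov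
metrisability) extract a weakly convergent subsequence (laws are probability measures once a_δ, b_δ
are joined, IsEndpointApprox.reachable), whose limit must be μ — contradiction. [difficulty:
provable-now] -/
@[route_item "route-CriticalPhenomena-SAWWeldingIdentification", crux]
def LimitUpgrade : Prop :=
  ∀ (D : Literature.Probability.RandomPlanarGeometry.DobrushinDomain) (a b : ℝ → Literature.Probability.LatticeModels.Site 2), Literature.Probability.RandomPlanarGeometry.SAW.IsEndpointApprox D a b → (∃ δ₀ : ℝ, 0 < δ₀ ∧ MeasureTheory.IsTightMeasureSet ((fun δ => (Literature.Probability.RandomPlanarGeometry.SAW.law D.carrier δ (a δ) (b δ)).map (fun γ => γ.curve)) '' Set.Ioc 0 δ₀)) → ∀ μ : MeasureTheory.Measure (Literature.Probability.RandomPlanarGeometry.CurveClass ℂ), MeasureTheory.IsProbabilityMeasure μ → (∀ (P : MeasureTheory.Measure (Literature.Probability.RandomPlanarGeometry.CurveClass ℂ)), MeasureTheory.IsProbabilityMeasure P → ∀ (δs : ℕ → ℝ), (∀ n, 0 < δs n) → Filter.Tendsto δs Filter.atTop (nhds 0) → (∀ f : BoundedContinuousFunction (Literature.Probability.RandomPlanarGeometry.CurveClass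 ℂ) ℝ, Filter.Tendsto (fun n => ∫ γ, f γ.curve ∂(Literature.Probability.RandomPlanarGeometry.SAW.law D.carrier (δs n) (a (δs n)) (b (δs n)))) Filter.atTop (nhds (∫ γ, f γ ∂P))) → P = μ) → Literature.Probability.RandomPlanarGeometry.TendstoLaw (fun δ (γ : Literature.Probability.RandomPlanarGeometry.SAW.DomainSAW D.carrier δ (a δ) (b δ)) => γ.curve) (fun δ => Literature.Probability.RandomPlanarGeometry.SAW.law D.carrier δ (a δ) (b δ)) id μ

/-- item stmt-CriticalPhenomena-4509 · support · rank 9 · closed · proved by Summit.CriticalPhenomena.SAWScalingLimit.Theorems.WeldingContinuity.weldingContinuity_proof (prover) · by planner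
sources: PommerenkeBBCM1992, AhlforsCA1979
[support] the welding is continuous along chords: if simple chords γ_n of (Ω; a, b) converge in
CurveClass ℂ to a simple chord γ, then W Q γ_n x → W Q γ x for every x > 0 and every welding
functional W. Classical: uniform convergence to a SIMPLE chord forces the banks to converge as
Carathéodory kernels with uniformly locally connected complements (no fjords survive), so the
normalised uniformisers converge uniformly up to the boundary (Pommerenke 1992 Thm 1.8, §2.2–2.3,
Cor. 2.4) and inverse boundary correspondences converge. This is the bridge from lattice weldings
(two-sided discrete harmonic measure of the walk, the card's h_δ) to WeldingLawOfLimit, and it gives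
the measurability clause of WeldingSetup. [difficulty: L] -/
@[route_item "route-CriticalPhenomena-SAWWeldingIdentification"]
def WeldingContinuity : Prop :=
  ∀ W : Literature.Probability.RandomPlanarGeometry.ConformalRectangle → Literature.Probability.RandomPlanarGeometry.CurveClass ℂ → ℝ → ℝ, (∀ (Q : Literature.Probability.RandomPlanarGeometry.ConformalRectangle) (γ : (Literature.Probability.RandomPlanarGeometry.CurveClass ℂ)) (s : ℝ) (L R : Set ℂ) (φ : Literature.Probability.RandomPlanarGeometry.ConformalEquiv UpperHalfPlane.upperHalfPlaneSet L) (ψ : Literature.Probability.RandomPlanarGeometry.ConformalEquiv UpperHalfPlane.upperHalfPlaneSet R), (γ ∈ Literature.Probability.RandomPlanarGeometry.CurveClass.simple ∧ γ.source = Q.pt 0 ∧ γ.target = Q.pt 2 ∧ γ.range ⊆ closure Q.carrier ∧ γ.range ∩ frontier Q.carrier ⊆ {Q.pt 0, Q.pt 2}) → (s = 1 ∨ s = -1) → (L ∪ R = Q.carrier \ γ.range ∧ Disjoint L R ∧ IsOpen L ∧ IsOpen R ∧ IsConnected L ∧ IsConnected R ∧ Q.pt 1 ∈ closure L ∧ Q.pt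 3 ∈ closure R) → (φ.HasBoundaryValue 0 (Q.pt 0) ∧ φ.HasBoundaryValueAtInfty (Q.pt 2) ∧ φ.HasBoundaryValue ((s : ℝ) : ℂ) (Q.pt 1) ∧ ψ.HasBoundaryValue 0 (Q.pt 0) ∧ ψ.HasBoundaryValueAtInfty (Q.pt 2) ∧ ψ.HasBoundaryValue (-((s : ℝ) : ℂ)) (Q.pt 3)) → ∀ x : ℝ, 0 < x → 0 < W Q γ x ∧ ψ.boundaryExtension (((s * x : ℝ)) : ℂ) = φ.boundaryExtension (((-(s * W Q γ x) : ℝ)) : ℂ)) → ∀ (Q : Literature.Probability.RandomPlanarGeometry.ConformalRectangle) (γs : ℕ → Literature.Probability.RandomPlanarGeometry.CurveClass ℂ) (γ : (Literature.Probability.RandomPlanarGeometry.CurveClass ℂ)), (∀ n, ((γs n) ∈ Literature.Probability.RandomPlanarGeometry.CurveClass.simple ∧ (γs n).source = Q.pt 0 ∧ (γs n).target = Q.pt 2 ∧ (γs n).range ⊆ closure Q.carrier ∧ (γs n).range ∩ frontier Q.carrier ⊆ {Q.pt 0, Q.pt 2})) → (γ ∈ Literature.Probability.RandomPlanarGeometry.CurveClass.simple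 ∧ γ.source = Q.pt 0 ∧ γ.target = Q.pt 2 ∧ γ.range ⊆ closure Q.carrier ∧ γ.range ∩ frontier Q.carrier ⊆ {Q.pt 0, Q.pt 2}) → Filter.Tendsto γs Filter.atTop (nhds γ) → ∀ x : ℝ, 0 < x → Filter.Tendsto (fun n => W Q (γs n) x) Filter.atTop (nhds (W Q γ x))

/-- item stmt-CriticalPhenomena-6981 · support · rank 9 · closed · proved by Summit.CriticalPhenomena.SAWScalingLimit.Theorems.ChordalSLE83Exists_proof @ 93199528ccef (prover) · by planner
[support] needs-fact: Literature.Probability.RandomPlanarGeometry.exists_isSLECurve (route-repair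
2026-08-15, cone guardrail 16 unproved). Chordal SLE_{8/3} EXISTS as a random curve in every
Dobrushin domain: ∀ D, ∃ Γ, IsSLECurve (8/3) D Γ — the κ = 8/3 instance of the named fact
exists_isSLECurve (inputs: Rohde–Schramm 2005 Thm 5.1 trace for κ ≠ 8, discharged as
hasSLETrace_of_ne_eight_holds; transience RS05 Thm 7.1 = tendsto_norm_sleTrace_atTop, undischarged;
Carathéodory boundary extension of a chordal uniformizing map, ConformalMap facts discharged). It is
the existence half of what any proof of SomeApproxLimit (ConvergesInLawToSLE 8/3 := ∃ Γ, IsSLECurve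
… ∧ …) must produce, hence the ONE undischarged cone fact an item of this route consumes; one line
from the fact once discharged (fun D => h (by positivity) D; checked in the planner sketch). Cone
audit of the route: no other item uses a named fact — CircleBridgeAbundance, ScreenOverlap,
NoDeepReturn, ScreeningRecursion, EndpointCouplingTame, EndpointCoupling are statements over SAW.law
/ discreteDomainGraph / meshPoint only; the Assembly needs 0 < x_c
(LawlerSchrammWerner2004SAW_connectiveConstant_bounds_holds, discharged) and -/
@[route_item "route-CriticalPhenomena-SAWWeldingIdentification", crux]
def ChordalSLE83Exists : Prop :=
  ∀ D : Literature.Probability.RandomPlanarGeometry.DobrushinDomain, ∃ Γ : (NNReal → ℝ) → Literature.Probability.RandomPlanarGeometry.CurveClass ℂ, Literature.Probability.RandomPlanarGeometry.IsSLECurve ((8 : NNReal) / 3) D Γ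

/-- item stmt-CriticalPhenomena-11048 · assembly · rank 9 · closed · proved by Summit.CriticalPhenomena.SAWScalingLimit.Theorems.sawWeldingIdentification_assembly_proof (prover) · by planner
[support] re-badge (route-repair g5) of the obsolete assembly sibling formerly rendered as Assembly2
(stmt-CriticalPhenomena-6920): the closing chain with the two SLE-trace facts as antecedents. Not an
assembly and not load-bearing — chordal SLE_{8/3} exists unconditionally
(Literature.Probability.RandomPlanarGeometry.exists_isSLECurve_eightThirds), so the deciding theorem
closes needs neither fact; kept only as a support record until restated into IdentifyFromWeldingAE. -/
@[route_item "route-CriticalPhenomena-SAWWeldingIdentification"]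
def Assembly : Prop :=
  WeldingLawOfLimit → RemovableLimit → EventualTight → WeldingSetup → WeldingRigidity → SLERemovableChord → IdentifyFromWelding → LimitUpgrade → ChordalSLE83Exists → SAWScalingLimit

-- records of items no longer active in this route (dropped / restated):
-- earlier Assembly2 (stmt-CriticalPhenomena-4510, dropped 2026-08-16T14:43:06Z): proved by Summit.CriticalPhenomena.SAWScalingLimit.Theorems.sawWeldingIdentification_assembly2_proof — WeldingLawOfLimit → RemovableLimit → EventualTight → WeldingSetup → WeldingRigidity → SLERemovableChord → IdentifyFromWelding → LimitUpgrade → ChordalSLE83Exists → SAWScalingLimit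
-- earlier Assembly22 (stmt-CriticalPhenomena-6920, dropped 2026-08-16T14:43:06Z): proved by Summit.CriticalPhenomena.SAWScalingLimit.Theorems.assembly22_proof — WeldingLawOfLimit → RemovableLimit → EventualTight → WeldingSetup → WeldingRigidity → SLERemovableChord → IdentifyFromWelding → LimitUpgrade → ChordalSLE83Exists → SAWScalingLimit

/-! D-0027 §2.1 — DECIDING THEOREM (planner-authored via `route open/edit --closes-file`; by planner-rbadge-CriticalPhenomena-SAWWeldingIde-f24df754-g8-0 2026-08-15T18:24:30Z):
its hypotheses are this route's items and its conclusion the sub-problem Statement (glue_lint), and it elaborates with this file. -/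

@[closes "route-CriticalPhenomena-SAWWeldingIdentification"] theorem closes (hW : WeldingLawOfLimit) (hR : RemovableLimit) (hT : EventualTight)
    (hS : WeldingSetup) (hRig : WeldingRigidity) (hC : SLERemovableChord)
    (hI : IdentifyFromWelding) (hL : LimitUpgrade) (hE : ChordalSLE83Exists) :
    _root_.SAWScalingLimit := by
  intro D a b hab
  -- Step 0. Complete the Dobrushin domain `D = (Ω; a, b)` to a conformal rectangle `Q` with
  -- `Q.chord 0 2 = D` (insert one auxiliary mark in each open boundary arc).
  obtain ⟨Q, rfl⟩ : ∃ Q : Literature.Probability.RandomPlanarGeometry.ConformalRectangle,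
      Q.chord 0 2 (by decide) = D := by
    obtain ⟨J, m, hm, hmem⟩ := D
    have h01 : m 0 < m 1 := hm (show (0 : Fin 2) < 1 by decide)
    have h0 : 0 ≤ m 0 ∧ m 0 < 1 := hmem 0
    have h1 : 0 ≤ m 1 ∧ m 1 < 1 := hmem 1
    refine ⟨⟨J, ![m 0, (m 0 + m 1) / 2, m 1, (m 1 + 1) / 2], ?_, ?_⟩, ?_⟩
    · refine Fin.strictMono_iff_lt_succ.2 fun k => ?_
      fin_cases k
      · show m 0 < (m 0 + m 1) / 2
        linarith
      · show (m 0 + m 1) / 2 < m 1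
        linarith
      · show m 1 < (m 1 + 1) / 2
        linarith
    · intro k
      fin_cases k
      · show m 0 ∈ Set.Ico (0 : ℝ) 1
        exact hmem 0
      · show (m 0 + m 1) / 2 ∈ Set.Ico (0 : ℝ) 1
        exact ⟨by linarith, by linarith⟩
      · show m 1 ∈ Set.Ico (0 : ℝ) 1
        exact hmem 1
      · show (m 1 + 1) / 2 ∈ Set.Ico (0 : ℝ) 1
        exact ⟨by linarith, by linarith⟩
    · simp only [Literature.Probability.RandomPlanarGeometry.MarkedDomain.chord]
      congr 1
      funext k
      fin_cases k <;> rfl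
  -- Step 1. The chordal SLE_{8/3} random curve `Γ` in `D` (item `ChordalSLE83Exists`; in tree this is
  -- Rohde–Schramm Thm 5.1 + 7.1 at `κ = 8/3`, `exists_isSLECurve_eightThirds`) and its law `μ = ℙ ∘ Γ⁻¹`;
  -- the Wiener measure is a probability measure by the proved Kolmogorov extension theorem.
  obtain ⟨Γ, hΓ⟩ := hE (Q.chord 0 2 (by decide))
  haveI : MeasureTheory.IsProbabilityMeasure Literature.Probability.Process.preWienerMeasure :=
    Literature.Probability.Process.isProbabilityMeasure_preWienerMeasure
      (Literature.Probability.Process.isProjectiveLimit_preWienerMeasure_of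
        Literature.Probability.Process.exists_isProjectiveLimit_holds)
  have hΓm : AEMeasurable Γ Literature.Probability.Process.preWienerMeasure := hΓ.1
  have hμ : MeasureTheory.IsProbabilityMeasure (Literature.Probability.Process.preWienerMeasure.map Γ) :=
    MeasureTheory.Measure.isProbabilityMeasure_map hΓm
  -- Step 2. Eventual tightness (EventualTight) + "every subsequential weak limit is `μ`"
  -- ⇒ the SAW laws converge in law to `μ` (LimitUpgrade).
  have hconv : Literature.Probability.RandomPlanarGeometry.TendstoLaw
      (fun δ (γ : Literature.Probability.RandomPlanarGeometry.SAW.DomainSAW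
        (Q.chord 0 2 (by decide)).carrier δ (a δ) (b δ)) => γ.curve)
      (fun δ => Literature.Probability.RandomPlanarGeometry.SAW.law
        (Q.chord 0 2 (by decide)).carrier δ (a δ) (b δ))
      id (Literature.Probability.Process.preWienerMeasure.map Γ) := by
    refine hL (Q.chord 0 2 (by decide)) a b hab (hT _ a b hab) _ hμ ?_
    -- every subsequential weak limit `P` equals `μ`:
    intro P hP δs hpos hδ hlim
    obtain ⟨hsign, W, hWmeas, hWpin⟩ := hS
    obtain ⟨s, hs, hconf⟩ := hsign Q
    refine hI Q W P (NNReal → ℝ) Literature.Probability.Process.preWienerMeasure Γ hP inferInstance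
      hΓm hWmeas ?_ ?_ ?_ ?_
    · -- P-a.s. the limit curve is a removable simple chord (RemovableLimit)
      exact hR Q a b hab P hP δs hpos hδ hlim
    · -- a.s. the SLE_{8/3} curve is a removable simple chord (SLERemovableChord)
      exact hC Q Γ hΓ
    · -- the welding separates removable chords (WeldingSetup + WeldingRigidity)
      intro γ γ' hγ hγ' heq
      obtain ⟨L, R, φ, ψ, hb, hn⟩ := hconf γ hγ.1
      obtain ⟨L', R', φ', ψ', hb', hn'⟩ := hconf γ' hγ'.1
      refine hRig Q γ γ' s L R L' R' φ ψ φ' ψ' (fun q => W Q γ q) hγ.1 hγ'.1 hγ.2 hs hb hb' hn hn'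
        ?_
      intro q hq
      have hq' : (0 : ℝ) < (q : ℝ) := by exact_mod_cast hq
      obtain ⟨hpos₁, hw₁⟩ := hWpin Q γ s L R φ ψ hγ.1 hs hb hn q hq'
      obtain ⟨-, hw₂⟩ := hWpin Q γ' s L' R' φ' ψ' hγ'.1 hs hb' hn' q hq'
      refine ⟨hpos₁, hw₁, ?_⟩
      rw [heq q hq]
      exact hw₂
    · -- the welding laws agree (WeldingLawOfLimit, at positive rational points)
      intro k x hx
      exact hW Literature.Probability.RandomPlanarGeometry.IsSLECurve.map_eq_holds W hWpin hWmeas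
        Q a b hab P hP δs hpos hδ hlim Γ hΓ k (fun i => (x i : ℝ)) (fun i => by exact_mod_cast hx i)
  -- Step 3. Convergence in law to `μ = ℙ ∘ Γ⁻¹` is convergence in law to the random curve `Γ`.
  refine ⟨Γ, hΓ, Filter.Eventually.of_forall fun δ =>
    Literature.Probability.RandomPlanarGeometry.SAW.aemeasurable_curve _ _ _ _, fun f => ?_⟩
  have h := hconv f
  simp only [id] at h
  rw [MeasureTheory.integral_map hΓm f.continuous.aestronglyMeasurable] at h
  exact h

end Summit.CriticalPhenomena.SAWScalingLimit.Theses.SAWWeldingIdentification
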